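import Literature.MathematicalPhysics.QuantumFieldTheory.Balaban1983to89.B1Eq324BenfattoClassSectEMemberCoRead
import Literature.MathematicalPhysics.QuantumFieldTheory.Balaban1983to89.B1Eq324BenfattoClassSectEMemberAtNode00
import Literature.MathematicalPhysics.QuantumFieldTheory.Balaban1983to89.Node00.OpsYSectEElim

/-!
# `Balaban1983to89.B1Eq324BenfattoClassSectEMemberAtLetters` — [Balaban1982Higgs1] (3.24) FOR THE GAUSSIAN `dμ_{C̃^{(k)}(Λ; U)}` OF
# [Balaban1985BackgroundPropagators] (3.157)–(3.158) AT NODE 00's NAMED LETTERS `Node00.CsDeltaCY` ∕ `Node00.CtildeKY`, every analytic input DISPLAYED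
# at those letters (seat dag-n08-b gen 32, CLAIM-6 = seat n08-d's OFFER-83; node N08 [Balaban1985UV3], row `h324c`)

statement-level companion of published sources with citation tags; every declaration here is a theorem; nothing here is a claim about the
Yang–Mills mass gap

THE PRINTED LOCUS.  [Balaban1985BackgroundPropagators] (= [B9]) Sect. E p. 428: *"We can parametrize this subspace … using part of the variables B, which
we denote by B̃. These are variables B restricted to the set of bonds Λ̃ … Variables B depend linearly on B̃ and we have B = CB̃, where C is a linear
operator. It is an identity operator on almost all bonds, except the bonds b₀ … (C*Δ_kC)⁻¹ = C̃^{(k)}(Λ) = C^{(k)}(Λ)↾_Λ̃, C^{(k)}(Λ) = C C̃^{(k)}(Λ) C*.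
(3.158) … it is defined by a positive definite operator C*Δ_kC with a lower bound γ₀ > 0 independent of k and U … These facts together with a uniform
exponential decay of C*Δ_kC implies bounds and uniform exponential decay for C^{(k)}(Λ)"*; Thm 3.15 p. 432 (3.187): *"|C^{(k)}(Λ; y, y′)| ≤ B₀e^{−δ₀|y−y′|},
y, y′ ∈ Λ"*.  [Balaban1985UV3] (= [B10]) p. 271: *"the Gaussian integral determined by the positive quadratic form ⟨A, C*Δ_kCA⟩ … γ₁ is an upper bound of
the positive, bounded operator C*Δ_kC"* (pp. 271–272); (24) p. 262 cites [Balaban1982Higgs1] (3.24) (node N08's row `h324c`).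

WHY THIS MODULE (cell `pub-ymgap`, seat `dag-n08-b` gen 32, CLAIM-6 = seat n08-d g26's OFFER-83 «the member half at NODE 00's NAMED letters»).  The two
halves of the member half of the IDENT for row `h324c` are in the tree: seat n08-d's `…ClassSectEMemberAtNode00.eq324_sectECovariance_node00_on_unit`
(p664951; the INDEX presentation of the variables `σ × κ` on the top-level index bonds of a member of def-Y's k-level torus index, discharged) and this
seat's `…ClassSectEMemberCoRead` (p665451; the member ROWS of a real coordinate matrix `𝕄(A)` read off an operator `A` in orthonormal fibre coordinates).
THIS FILE composes them AT THE LETTERS: `A := Node00.CsDeltaCY x 𝔏 𝔢 U` ((3.157)'s `C*Δ_kC`) and its sector inverse `Ã := Node00.CtildeKY x 𝔏 𝔢 U`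
((3.158)'s `C̃^{(k)}(Λ) = (C*Δ_kC)⁻¹` on the `Λ̃`-functions), variables on `Λ̃ = 𝔢.LamT`, so that [Balaban1982Higgs1] (3.24) for the Gaussian
`𝒩(0, 𝕄(C*Δ_kC)⁻¹) = 𝒩(0, 𝕄(C̃^{(k)}))` holds with EVERY remaining input a DISPLAYED statement about def-Y's letters: (R1) pairing-self-adjointness of
`C*Δ_kC` (n06-j's `IsSymmTr 1` at `M_N(ℂ)`), (R2)–(R3) the form bounds `γ₀ ≤ C*Δ_kC ≤ γ₁` on `Λ̃`-supported frame-valued functions (p. 428, G-B9-09; [B10]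
pp. 271–272), (R4) def-Y's unit clause for the `Λ̃`-corner, (R5) `C̃^{(k)}` frame-valued on frame vectors (the 𝔤-reality row; automatic for a basis), (R6) «`C`, `C*`
act as the identity on `Λ̃`» (p. 428) — a THEOREM at def-Y's genuine `elimCY ∕ elimCtY` (§5), (R7) ROW 24's bound conjunct of `B9.Thm315FullPrinted` for
`C^{(k)}(Λ; U)` in def-Y's `siteKernelOfOp` shape.

WHAT IS PROVED (standard axioms; no `sorry`; no definition).
* §1 def-Y sector algebra (generic fibre `𝔸`): `secY_single_of` ∕ `secY_apply_self_of_support` (a one-point function at a `Λ̃`-bond, resp. any `Λ̃`-supported function, is fixed by `P_Λ̃`) ·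
  `CtildeKY_apply_of_not_lamT` (`C̃^{(k)}Φ` vanishes off `Λ̃`) · ★ `CsDeltaCY_CtildeKY_apply_of_lamT` ((R4) ⇒ `(C*Δ_kC)(C̃^{(k)}Φ) = Φ` on `Λ̃` for
  `Λ̃`-supported `Φ`, from def-Y's `CsDeltaCY_mul_CtildeKY`) · ★★ `CkY_single_apply_eq_CtildeKY` ((R6) ⇒ `(C^{(k)}(δ_{b′} ⊗ E))(b) = (C̃^{(k)}(δ_{b′} ⊗ E))(b)`
  for `b, b′ ∈ Λ̃` — print's «`C̃^{(k)}(Λ) = C^{(k)}(Λ)↾Λ̃`») · ★ `kernelReading_CtildeKY_of_row24` ((R6) + (R7) ⇒ the homogeneous kernel reading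
  `‖(C̃^{(k)}(δ_{ι s′} ⊗ E))(ι s)‖ ≤ B₀‖E‖e^{−δ₀|y_{ι s} − y_{ι s′}|}` on `Λ̃`, via p665451 §2b).
* §2 the sector-inverse rows of p665451 AT THE LETTERS: `exists_assemble_CtildeKY_single` (hval) · `frameRead_CsDeltaCY_CtildeKY` (hinv).
* §3 ★★★ `eq324_CtildeKY_node00_on_unit` — p664951 `eq324_sectECovariance_node00_on_unit` at `T := 𝕄(C*Δ_kC)` with its three displayed rows SUPPLIED from
  (R1)–(R7) by p665451 (`coordMatrix_symm_of_selfAdjoint`, `coercive_coordMatrix`, `form_le_coordMatrix`, `inv_coordMatrix_eq`, `abs_coordMatrix_le`):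
  class scalars and the frame constants FIRST, then for EVERY `η ∈ (0,1]`, member `x`, letters `𝔏 𝔢`, background `U`, pairing `β`, frame `e`, bijection
  `ι : σ → Λ̃`: a window `Λ_w ⊂ ℤ^{2(d+1)+1}`, `e′ : σ × κ ≃ ↥Λ_w` presenting `𝒩(0, 𝕄(C*Δ_kC)⁻¹)`, the a.e. box identity and the (3.24) pair.
* §4 `inv_coordMatrix_CsDeltaCY_eq` — under (R4), (R5) the presented covariance IS `𝕄(C̃^{(k)})` (the name print gives it); one `example` (the scalar side of §3 elaborates).
* §5 AT def-Y's GENUINE LETTERS (`Node00.OpsYSectEElim`: `Λ̃ = lamTY`, `C = elimCY`, `C* = elimCtY` over the averaged-field parameter `𝔳`): ★ `secY_mul_elimCY_mul_secY` ·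
  ★ `secY_mul_elimCtY_mul_secY` — ROW (R6) IS A THEOREM for the letters of record (from def-Y's `elimCY_apply_of_lamTY`, `elimCtY_eq`, `not_lamTY_pivIY`);
  ★★★ `eq324_CtildeKY_node00_ofRecordTC_on_unit` — §3 at the seven-letter record `sectELettersYOfRecordTC x 𝔳 𝔢₀` with (R6) DISCHARGED.
HONEST SCOPE.  Count-neutral composition BY NAME plus def-Y sector bookkeeping; (R1)–(R7) are node N06's [B9] content (Thms 3.11 ∕ 3.15, Sect. E p. 428,
G-B9-09) and NODE 00's letter facts, DISPLAYED not proved; NO letter is constructed or pinned here (`𝔏`, `𝔢`, `U`, the frame are universally quantified);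
the IDENT's remaining items after this file are NODE 00's identification `(𝔖 k).μ = 𝒩(0, 𝕄(C̃^{(k)})).map Φ` with its box and Hamiltonian letters (class II)
and the window `b₁ < b₀` — NOT made, NOT commissioned, NOT claimed; nothing of [Balaban1985UV3], [Balaban1985BackgroundPropagators], [Balaban1982Higgs1]
or [BenfattoEtAl1978] is asserted or discharged; node N08 is NOT discharged; nothing about d = 4, the continuum, OS axioms, a mass gap or the Clay problem.
-/

noncomputable section

open MeasureTheory Finset Matrix

namespace Literature.MathematicalPhysics.QuantumFieldTheory.Balaban1983to89.B1Eq324BenfattoClassSectEMemberAtLetters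

open Literature.MathematicalPhysics.QuantumFieldTheory
open Literature.MathematicalPhysics.QuantumFieldTheory.Balaban1983to89.B1Eq324BenfattoLemma
open Literature.MathematicalPhysics.QuantumFieldTheory.Balaban1983to89.B6KLevelCensusIndexV1 (KIdx)
open Literature.MathematicalPhysics.QuantumFieldTheory.Balaban1983to89.B6Ineq2142KLevelV1 (lvl)
open Literature.MathematicalPhysics.QuantumFieldTheory.Balaban1983to89.B6GlobalChartV1 (PV domT)
open Literature.MathematicalPhysics.QuantumFieldTheory.Balaban1983to89.B9PinMembersKLevelV1 (MemberY)
open Literature.MathematicalPhysics.QuantumFieldTheory.Balaban1983to89.B9PinGeometryKLevelV1 (kLab unitDistY inΛY inΛY_top)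
open Literature.MathematicalPhysics.QuantumFieldTheory.Balaban1983to89.Node00
  (IBondY CfgY BallY deltaY secY secY_apply_of secY_apply_of_not secY_idem secCornerY CovLettersY SectELettersY CsDeltaCY CtildeKY CkY elimCΛY
    elimCtΛY secΛY CkY_apply CsDeltaCY_mul_CtildeKY secY_mul_CtildeKY AvY lamTY elimCY elimCtY not_lamTY_pivIY elimCY_apply_of_lamTY elimCtY_eq
    sectELettersYOfRecordTC)
open Literature.MathematicalPhysics.QuantumFieldTheory.Balaban1983to89.B1Eq324BenfattoClassSectEMemberCoRead
  (coord_assemble exists_assemble_of_support_mem_span frameRead_of_sectorIdentity coordMatrix_symm_of_selfAdjoint coercive_coordMatrix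
    form_le_coordMatrix inv_coordMatrix_eq kernelReading_homog_of_ball abs_coordMatrix_le norm_le_of_iSup_closedBall_le deltaY_eq_single)
open Literature.MathematicalPhysics.QuantumFieldTheory.Balaban1983to89.B1Eq324BenfattoClassSectEMemberAtNode00 (eq324_sectECovariance_node00_on_unit)

variable {d ℓ : ℕ} {hd : 1 ≤ d + 1} {hL : Odd (ℓ + 1) ∧ 1 < ℓ + 1} {w₀ w₁ : ℝ} {Mstar : ℕ}
variable {𝔸 : Type} [NormedRing 𝔸] [NormedAlgebra ℂ 𝔸] [CompleteSpace 𝔸]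

/-! ## §1  def-Y sector algebra at the Sect. E letters -/

section Sector

variable {x : MemberY d ℓ hd hL w₀ w₁ Mstar} [DecidableEq (IBondY x.toKIdx)] {𝔏 : CovLettersY 𝔸 x} {𝔢 : SectELettersY 𝔸 x}

omit [CompleteSpace 𝔸] in
/-- a one-point function `δ_{b′} ⊗ E` at a `Λ̃`-bond is `Λ̃`-supported: `P_Λ̃(δ_{b′} ⊗ E) = δ_{b′} ⊗ E`. [cite: Balaban1985BackgroundPropagators, p.428 («variables B restricted to the set of bonds Λ̃»), bookkeeping] -/
theorem secY_single_of {S : IBondY x.toKIdx → Prop} {b' : IBondY x.toKIdx} (hb' : S b') (E : 𝔸) :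
    secY 𝔸 S (Pi.single b' E) = Pi.single b' E := by
  funext b
  by_cases hb : S b
  · exact secY_apply_of hb _
  · rw [secY_apply_of_not hb, Pi.single_eq_of_ne (fun h : b = b' => hb (h ▸ hb'))]

omit [CompleteSpace 𝔸] [DecidableEq (IBondY x.toKIdx)] in
/-- more generally a function vanishing off `S` is fixed by `P_S`. [cite: Balaban1985BackgroundPropagators, p.428 («B = 0 on Λᶜ»), bookkeeping] -/
theorem secY_apply_self_of_support {S : IBondY x.toKIdx → Prop} {Φ : IBondY x.toKIdx → 𝔸} (hΦ : ∀ b, ¬ S b → Φ b = 0) :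
    secY 𝔸 S Φ = Φ := by
  funext b
  by_cases hb : S b
  · exact secY_apply_of hb _
  · rw [secY_apply_of_not hb, hΦ b hb]

omit [DecidableEq (IBondY x.toKIdx)] in
/-- `C̃^{(k)}(Λ; U)Φ` vanishes off `Λ̃` (def-Y's `secY_mul_CtildeKY`: the sector inverse is supported in `Λ̃`). [cite: Balaban1985BackgroundPropagators, (3.158) p.428, bookkeeping] -/
theorem CtildeKY_apply_of_not_lamT (U : CfgY 𝔸 x.toKIdx) (Φ : IBondY x.toKIdx → 𝔸) {b : IBondY x.toKIdx} (hb : ¬ 𝔢.LamT b) :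
    CtildeKY x 𝔏 𝔢 U Φ b = 0 := by
  have h := congrArg (fun T : Module.End ℂ (IBondY x.toKIdx → 𝔸) => T Φ b) (secY_mul_CtildeKY (𝔏 := 𝔏) (𝔢 := 𝔢) U)
  simp only [Module.End.mul_apply] at h
  rw [← h, secY_apply_of_not hb]

omit [DecidableEq (IBondY x.toKIdx)] in
/-- ★ **(3.158) on the `Λ̃`-functions, pointwise**: under def-Y's unit clause for the `Λ̃`-corner of `C*Δ_kC` ((R4); «positive definite … lower bound γ₀», p.428,
NOT claimed), `((C*Δ_kC)(C̃^{(k)}Φ))(b) = Φ(b)` for `b ∈ Λ̃` and `Λ̃`-supported `Φ` (def-Y's `CsDeltaCY_mul_CtildeKY : (C*Δ_kC)·C̃^{(k)} = P_Λ̃`).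
[cite: Balaban1985BackgroundPropagators, (3.158) p.428] -/
theorem CsDeltaCY_CtildeKY_apply_of_lamT (U : CfgY 𝔸 x.toKIdx) (hunit : IsUnit (secCornerY 𝔸 𝔢.LamT (CsDeltaCY x 𝔏 𝔢 U)))
    (Φ : IBondY x.toKIdx → 𝔸) (hΦ : ∀ b, ¬ 𝔢.LamT b → Φ b = 0) (b : IBondY x.toKIdx) :
    CsDeltaCY x 𝔏 𝔢 U (CtildeKY x 𝔏 𝔢 U Φ) b = Φ b := by
  have h := congrArg (fun T : Module.End ℂ (IBondY x.toKIdx → 𝔸) => T Φ b) (CsDeltaCY_mul_CtildeKY (𝔏 := 𝔏) (𝔢 := 𝔢) U hunit)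
  simp only [Module.End.mul_apply] at h
  rw [h, secY_apply_self_of_support hΦ]

/-- ★★ **«`C̃^{(k)}(Λ) = C^{(k)}(Λ)↾Λ̃`» AT THE LETTERS**: if the parametrisation `C` and its adjoint act as the identity on `Λ̃` ((R6): `P_Λ̃·C·P_Λ̃ = P_Λ̃`,
`P_Λ̃·C*·P_Λ̃ = P_Λ̃` — print's «an identity operator on almost all bonds»), then for `b, b′ ∈ Λ̃` the kernel entries of `C^{(k)}(Λ; U) = C C̃^{(k)} C*` and
of `C̃^{(k)}(Λ; U)` on the one-point functions agree: `(C^{(k)}(δ_{b′} ⊗ E))(b) = (C̃^{(k)}(δ_{b′} ⊗ E))(b)`.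
[cite: Balaban1985BackgroundPropagators, (3.157)–(3.158) p.428 («C … is an identity operator on almost all bonds»; «C̃^{(k)}(Λ) = C^{(k)}(Λ)↾Λ̃»)] -/
theorem CkY_single_apply_eq_CtildeKY (U : CfgY 𝔸 x.toKIdx)
    (hC : secY 𝔸 𝔢.LamT * 𝔢.elimC U * secY 𝔸 𝔢.LamT = secY 𝔸 𝔢.LamT)
    (hCt : secY 𝔸 𝔢.LamT * 𝔢.elimCt U * secY 𝔸 𝔢.LamT = secY 𝔸 𝔢.LamT)
    {b b' : IBondY x.toKIdx} (hb : 𝔢.LamT b) (hb' : 𝔢.LamT b') (E : 𝔸) :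
    CkY x 𝔏 𝔢 U (Pi.single b' E) b = CtildeKY x 𝔏 𝔢 U (Pi.single b' E) b := by
  -- (i) `C*` read from the `Λ`-functions to the `Λ̃`-functions fixes `δ_{b′} ⊗ E`
  have h1 : elimCtΛY x 𝔢 U (Pi.single b' E) = Pi.single b' E := by
    have hΛ : secΛY 𝔸 x (Pi.single b' E) = Pi.single b' E := secY_single_of (𝔢.LamT_inΛ _ hb') E
    have hT : secY 𝔸 𝔢.LamT (Pi.single b' E : IBondY x.toKIdx → 𝔸) = Pi.single b' E := secY_single_of hb' E
    have h := congrArg (fun T : Module.End ℂ (IBondY x.toKIdx → 𝔸) => T (Pi.single b' E)) hCt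
    simp only [Module.End.mul_apply, hT] at h
    show (secY 𝔸 𝔢.LamT * 𝔢.elimCt U * secΛY 𝔸 x) (Pi.single b' E) = Pi.single b' E
    simp only [Module.End.mul_apply, hΛ]
    exact h
  -- (ii) the middle factor is `Λ̃`-supported
  set Ψ := CtildeKY x 𝔏 𝔢 U (Pi.single b' E) with hΨ
  have hΨs : secY 𝔸 𝔢.LamT Ψ = Ψ := secY_apply_self_of_support fun c hc => CtildeKY_apply_of_not_lamT U _ hc
  -- (iii) `C` read from the `Λ̃`-functions to the `Λ`-functions fixes the values on `Λ̃`
  have h3 : elimCΛY x 𝔢 U Ψ b = Ψ b := by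
    have h := congrArg (fun T : Module.End ℂ (IBondY x.toKIdx → 𝔸) => T Ψ b) hC
    simp only [Module.End.mul_apply, hΨs, secY_apply_of hb] at h
    show (secΛY 𝔸 x * 𝔢.elimC U * secY 𝔸 𝔢.LamT) Ψ b = Ψ b
    simp only [Module.End.mul_apply, hΨs]
    rw [secΛY, secY_apply_of (𝔢.LamT_inΛ _ hb)]
    exact h
  rw [CkY_apply, Module.End.mul_apply, Module.End.mul_apply, h1]
  exact h3

/-- ★ **THE (3.187)-TYPE KERNEL READING OF `C̃^{(k)}(Λ; U)` ON `Λ̃` FROM ROW 24's BOUND CONJUNCT FOR `C^{(k)}(Λ; U)`** ((R6) + (R7)): on a finite-dimensional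
fibre, `sup_{‖E‖≤1}‖(C^{(k)}(δ_{b′} ⊗ E))(b)‖ ≤ B₀e^{−δ₀|y_b − y_{b′}|}` for `b, b′ ∈ Λ` (the shape of `B9.Thm315FullPrinted`'s last conjunct at def-Y's
`siteKernelOfOp … (CkY x 𝔏 𝔢) id id`) gives, along any `ι : σ → Λ̃`, the homogeneous reading `‖(C̃^{(k)}(δ_{ι s′} ⊗ E))(ι s)‖ ≤ B₀‖E‖e^{−δ₀|y_{ι s} − y_{ι s′}|}`
(p665451 `norm_le_of_iSup_closedBall_le` ∘ `kernelReading_homog_of_ball`, `deltaY_eq_single`). [cite: Balaban1985BackgroundPropagators, Thm 3.15 (3.187) p.432, (3.158) p.428] -/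
theorem kernelReading_CtildeKY_of_row24 [FiniteDimensional ℝ 𝔸] (U : CfgY 𝔸 x.toKIdx)
    (hC : secY 𝔸 𝔢.LamT * 𝔢.elimC U * secY 𝔸 𝔢.LamT = secY 𝔸 𝔢.LamT)
    (hCt : secY 𝔸 𝔢.LamT * 𝔢.elimCt U * secY 𝔸 𝔢.LamT = secY 𝔸 𝔢.LamT) {B₀ δ₀ : ℝ} (hB₀ : 0 ≤ B₀)
    (hrow : ∀ b b' : IBondY x.toKIdx, inΛY x b → inΛY x b' →
      (⨆ E : BallY 𝔸, ‖CkY x 𝔏 𝔢 U (deltaY b' (E : 𝔸)) b‖) ≤ B₀ * Real.exp (-(δ₀ * unitDistY x b b')))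
    {σ : Type} (ι : σ → IBondY x.toKIdx) (hιT : ∀ s, 𝔢.LamT (ι s)) (s s' : σ) (E : 𝔸) :
    ‖((CtildeKY x 𝔏 𝔢 U).restrictScalars ℝ) (Pi.single (ι s') E) (ι s)‖ ≤ B₀ * ‖E‖ * Real.exp (-(δ₀ * unitDistY x (ι s) (ι s'))) := by
  have hK : 0 ≤ B₀ * Real.exp (-(δ₀ * unitDistY x (ι s) (ι s'))) := by positivity
  -- row 24 at `(ι s, ι s′) ∈ Λ × Λ`, rewritten to `C̃^{(k)}` and `Pi.single`
  have hsup : (⨆ E' : ↥(Metric.closedBall (0 : 𝔸) 1),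
      ‖((CtildeKY x 𝔏 𝔢 U).restrictScalars ℝ) (Pi.single (ι s') (E' : 𝔸)) (ι s)‖) ≤
        B₀ * Real.exp (-(δ₀ * unitDistY x (ι s) (ι s'))) := by
    have h := hrow (ι s) (ι s') (𝔢.LamT_inΛ _ (hιT s)) (𝔢.LamT_inΛ _ (hιT s'))
    have hfun : (fun E' : BallY 𝔸 => ‖CkY x 𝔏 𝔢 U (deltaY (ι s') (E' : 𝔸)) (ι s)‖) =
        fun E' : ↥(Metric.closedBall (0 : 𝔸) 1) => ‖((CtildeKY x 𝔏 𝔢 U).restrictScalars ℝ) (Pi.single (ι s') (E' : 𝔸)) (ι s)‖ := by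
      funext E'
      rw [deltaY_eq_single, CkY_single_apply_eq_CtildeKY U hC hCt (hιT s) (hιT s'), LinearMap.restrictScalars_apply]
    rw [hfun] at h
    exact h
  have hball := norm_le_of_iSup_closedBall_le ((CtildeKY x 𝔏 𝔢 U).restrictScalars ℝ) (ι s) (ι s') hsup
  have h := kernelReading_homog_of_ball ((CtildeKY x 𝔏 𝔢 U).restrictScalars ℝ) hball E
  calc ‖((CtildeKY x 𝔏 𝔢 U).restrictScalars ℝ) (Pi.single (ι s') E) (ι s)‖
      ≤ B₀ * Real.exp (-(δ₀ * unitDistY x (ι s) (ι s'))) * ‖E‖ := h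
    _ = B₀ * ‖E‖ * Real.exp (-(δ₀ * unitDistY x (ι s) (ι s'))) := by ring

end Sector

/-! ## §2  The sector-inverse rows of `…ClassSectEMemberCoRead` at the letters -/

section Rows

variable {x : MemberY d ℓ hd hL w₀ w₁ Mstar} [DecidableEq (IBondY x.toKIdx)] {𝔏 : CovLettersY 𝔸 x} {𝔢 : SectELettersY 𝔸 x}
variable {κ : Type} [Fintype κ] [DecidableEq κ] {σ : Type} [Fintype σ] [DecidableEq σ]

omit [DecidableEq σ] in
/-- hval: along a bijection `ι : σ → Λ̃` and an orthonormal frame `e` for which `C̃^{(k)}` is frame-valued on frame vectors ((R5)), each `C̃^{(k)}(δ_{ι q.1} ⊗ e_{q.2})`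
IS a frame-assembled function `Φ_w` (p665451 `exists_assemble_of_support_mem_span`; the support is `Λ̃ = ι(σ)` by `CtildeKY_apply_of_not_lamT`).
[cite: Balaban1985BackgroundPropagators, (3.158) p.428, bookkeeping] -/
theorem exists_assemble_CtildeKY_single (U : CfgY 𝔸 x.toKIdx) (β : 𝔸 →ₗ[ℝ] 𝔸 →ₗ[ℝ] ℝ) (e : κ → 𝔸)
    (he : ∀ c c', β (e c) (e c') = if c = c' then 1 else 0) (ι : σ → IBondY x.toKIdx) (hι : Function.Injective ι)
    (hTι : ∀ b, 𝔢.LamT b → b ∈ Set.range ι)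
    (hF : ∀ (q : σ × κ) (b : IBondY x.toKIdx), CtildeKY x 𝔏 𝔢 U (Pi.single (ι q.1) (e q.2)) b ∈ Submodule.span ℝ (Set.range e))
    (q : σ × κ) :
    ∃ w : σ × κ → ℝ, ((CtildeKY x 𝔏 𝔢 U).restrictScalars ℝ) (Pi.single (ι q.1) (e q.2)) =
      fun b => ∑ r, w r • (Pi.single (ι r.1) (e r.2) : IBondY x.toKIdx → 𝔸) b := by
  rw [LinearMap.restrictScalars_apply]
  refine exists_assemble_of_support_mem_span β e ι he hι _ (fun b hb => ?_) (hF q)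
  exact CtildeKY_apply_of_not_lamT U _ fun h => hb (hTι b h)

omit [Fintype κ] [DecidableEq κ] [Fintype σ] [DecidableEq σ] in
/-- hinv: under (R4), `((C*Δ_kC)(C̃^{(k)}(δ_{ι q.1} ⊗ e_{q.2})))(ι p.1) = (δ_{ι q.1} ⊗ e_{q.2})(ι p.1)` along `ι : σ → Λ̃`, read in the frame
(p665451 `frameRead_of_sectorIdentity` ∘ `CsDeltaCY_CtildeKY_apply_of_lamT`). [cite: Balaban1985BackgroundPropagators, (3.158) p.428, bookkeeping] -/
theorem frameRead_CsDeltaCY_CtildeKY (U : CfgY 𝔸 x.toKIdx) (hunit : IsUnit (secCornerY 𝔸 𝔢.LamT (CsDeltaCY x 𝔏 𝔢 U)))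
    (β : 𝔸 →ₗ[ℝ] 𝔸 →ₗ[ℝ] ℝ) (e : κ → 𝔸) (ι : σ → IBondY x.toKIdx) (hιT : ∀ s, 𝔢.LamT (ι s)) (p q : σ × κ) :
    β (e p.2) (((CsDeltaCY x 𝔏 𝔢 U).restrictScalars ℝ) (((CtildeKY x 𝔏 𝔢 U).restrictScalars ℝ) (Pi.single (ι q.1) (e q.2))) (ι p.1)) =
      β (e p.2) ((Pi.single (ι q.1) (e q.2) : IBondY x.toKIdx → 𝔸) (ι p.1)) := by
  refine frameRead_of_sectorIdentity β e ι _ _ (fun q s => ?_) p q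
  rw [LinearMap.restrictScalars_apply, LinearMap.restrictScalars_apply]
  exact CsDeltaCY_CtildeKY_apply_of_lamT U hunit _
    (fun b hb => Pi.single_eq_of_ne (fun h : b = ι q.1 => hb (h ▸ hιT q.1)) _) (ι s)

end Rows

/-! ## §3  [Balaban1982Higgs1] (3.24) for `dμ_{C̃^{(k)}(Λ; U)}` at NODE 00's named letters -/

section Door

/-- ★★★ **(3.24) FOR THE GAUSSIAN `dμ_{C̃^{(k)}(Λ; U)}` OF (3.157)–(3.158) AT NODE 00's NAMED LETTERS, AT EVERY COUPLING `η ∈ (0,1]`.**  A finite frame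
index `κ ≠ ∅`, the class scalars `γ₀, γ₁ > 0`, `B₀ ≥ 0`, `δ₀ > 0`, the frame constants `c_β, n_e ≥ 0` and the (3.24) letters FIRST ⇒ `∃ b₁ ∀ b₀ > b₁ ∃ C ≥ 0`
such that for EVERY `η ∈ (0,1]`, EVERY member `x` of def-Y's k-level V1 torus index, EVERY Sect.-E letter records `𝔏 : CovLettersY 𝔸 x`, `𝔢 : SectELettersY 𝔸 x`
and background `U` (fibre `𝔸` any complete normed `ℂ`-algebra, finite-dimensional over ℝ), EVERY symmetric real pairing `β` with a frame `e : κ → 𝔸`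
orthonormal for it (`|β(e_c, v)| ≤ c_β‖v‖`, `‖e_c‖ ≤ n_e`), EVERY bijection `ι : σ → Λ̃ = 𝔢.LamT` (`σ ≠ ∅`), GIVEN AT THE LETTERS: (R1) `C*Δ_kC` is
`β`-self-adjoint over the carrier; (R2)(R3) `γ₀·Σ_bβ(Φb,Φb) ≤ Σ_bβ(Φb,(C*Δ_kC Φ)b) ≤ γ₁·Σ_bβ(Φb,Φb)` for every `Λ̃`-supported frame-valued `Φ`; (R4)
`IsUnit (secCornerY 𝔸 Λ̃ (C*Δ_kC))`; (R5) `C̃^{(k)}(δ_{ι q.1} ⊗ e_{q.2})` frame-valued; (R6) `P_Λ̃·C·P_Λ̃ = P_Λ̃ = P_Λ̃·C*·P_Λ̃`; (R7) row 24's bound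
`sup_{‖E‖≤1}‖(C^{(k)}(Λ;U)(δ_{b′} ⊗ E))(b)‖ ≤ B₀e^{−δ₀|y_b−y_{b′}|}` on `Λ` — the conclusion of seat n08-d's `eq324_sectECovariance_node00_on_unit` for
`T := 𝕄(C*Δ_kC)` (the coordinate matrix `β(e_{p.2}, (C*Δ_kC(δ_{ι q.1} ⊗ e_{q.2}))(ι p.1))` on `σ × κ`): a window `Λ_w ⊂ ℤ^{2(d+1)+1}`, `e′ : σ × κ ≃ ↥Λ_w`
presenting `𝒩(0, 𝕄(C*Δ_kC)⁻¹)`, the a.e. identity of the pulled-back uniform box with `smallFieldSet Λ_w p`, and the (3.24) pair for all `(s, I ⊇ J, 𝔞)` with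
`I ≠ ∅`, `J ⊆ Λ_w`, `sup|𝔞| ≤ c·η^σ`.  Proof: p665451's rows at `A := C*Δ_kC`, `Ã := C̃^{(k)}` (§1–§2) into p664951 at `(γ₀, γ₁, c_βn_eB₀, δ₀)`.
[cite: Balaban1985BackgroundPropagators, (3.155)–(3.158) pp.427–428, Thm 3.15 (3.187) p.432; Balaban1985UV3, (24) p.262, (58) p.270, pp.271–272; Balaban1982Higgs1,
(3.24) p.616; BenfattoEtAl1978, Lemma (4.5)–(4.7) p.152 (class form; the bent window, the presentation and the coordinates are ours)] -/
theorem eq324_CtildeKY_node00_on_unit (κ : Type) [Fintype κ] [DecidableEq κ] [Nonempty κ] {γ₀ γ₁ B₀ δ₀ cβ ne : ℝ} (hγ₀ : 0 < γ₀)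
    (hγ₁ : 0 < γ₁) (hB₀ : 0 ≤ B₀) (hδ₀ : 0 < δ₀) (hcβ : 0 ≤ cβ) (hne : 0 ≤ ne) (t D : ℕ) {ϰ : ℝ} (hϰ : 0 < ϰ) {p₀ σ' c κ' : ℝ}
    (hp₀ : 2 / 3 < p₀) (hσ : 0 < σ') (hc : 0 ≤ c) (hκ : 0 < κ') (hκσ : κ' < σ' * (t + 1)) :
    ∃ b₁ : ℝ, ∀ b₀ : ℝ, b₁ < b₀ → ∃ C : ℝ, 0 ≤ C ∧ ∀ η : ℝ, 0 < η → η ≤ 1 →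
      ∀ {ℓ : ℕ} {hd : 1 ≤ d + 1} {hL : Odd (ℓ + 1) ∧ 1 < ℓ + 1} {w₀ w₁ : ℝ} {Mstar : ℕ} (x : MemberY d ℓ hd hL w₀ w₁ Mstar)
        [DecidableEq (IBondY x.toKIdx)] {𝔸 : Type} [NormedRing 𝔸] [NormedAlgebra ℂ 𝔸] [CompleteSpace 𝔸] [FiniteDimensional ℝ 𝔸]
        (𝔏 : CovLettersY 𝔸 x) (𝔢 : SectELettersY 𝔸 x) (U : CfgY 𝔸 x.toKIdx)
        (β : 𝔸 →ₗ[ℝ] 𝔸 →ₗ[ℝ] ℝ), (∀ a b, β a b = β b a) →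
      ∀ (e : κ → 𝔸), (∀ c c', β (e c) (e c') = if c = c' then 1 else 0) → (∀ (c : κ) (v : 𝔸), |β (e c) v| ≤ cβ * ‖v‖) →
        (∀ c, ‖e c‖ ≤ ne) →
      ∀ {σ : Type} [Fintype σ] [DecidableEq σ] [Nonempty σ] (ι : σ → IBondY x.toKIdx), Function.Injective ι →
        (∀ s, 𝔢.LamT (ι s)) → (∀ b, 𝔢.LamT b → b ∈ Set.range ι) →
        (∀ Φ Ψ : IBondY x.toKIdx → 𝔸, ∑ b, β (Ψ b) (((CsDeltaCY x 𝔏 𝔢 U).restrictScalars ℝ) Φ b) =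
          ∑ b, β (((CsDeltaCY x 𝔏 𝔢 U).restrictScalars ℝ) Ψ b) (Φ b)) →
        (∀ Φ : IBondY x.toKIdx → 𝔸, (∀ b, b ∉ Set.range ι → Φ b = 0) → (∀ b, Φ b ∈ Submodule.span ℝ (Set.range e)) →
          γ₀ * ∑ b, β (Φ b) (Φ b) ≤ ∑ b, β (Φ b) (((CsDeltaCY x 𝔏 𝔢 U).restrictScalars ℝ) Φ b)) →
        (∀ Φ : IBondY x.toKIdx → 𝔸, (∀ b, b ∉ Set.range ι → Φ b = 0) → (∀ b, Φ b ∈ Submodule.span ℝ (Set.range e)) →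
          ∑ b, β (Φ b) (((CsDeltaCY x 𝔏 𝔢 U).restrictScalars ℝ) Φ b) ≤ γ₁ * ∑ b, β (Φ b) (Φ b)) →
        IsUnit (secCornerY 𝔸 𝔢.LamT (CsDeltaCY x 𝔏 𝔢 U)) →
        (∀ (q : σ × κ) (b : IBondY x.toKIdx), CtildeKY x 𝔏 𝔢 U (Pi.single (ι q.1) (e q.2)) b ∈ Submodule.span ℝ (Set.range e)) →
        secY 𝔸 𝔢.LamT * 𝔢.elimC U * secY 𝔸 𝔢.LamT = secY 𝔸 𝔢.LamT →
        secY 𝔸 𝔢.LamT * 𝔢.elimCt U * secY 𝔸 𝔢.LamT = secY 𝔸 𝔢.LamT →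
        (∀ b b' : IBondY x.toKIdx, inΛY x b → inΛY x b' →
          (⨆ E : BallY 𝔸, ‖CkY x 𝔏 𝔢 U (deltaY b' (E : 𝔸)) b‖) ≤ B₀ * Real.exp (-(δ₀ * unitDistY x b b'))) →
      ∃ (Λ : Finset (B1Eq324BenfattoLemma.Site (d + 1 + (d + 1) + 1))) (e' : σ × κ ≃ ↥Λ),
        ((gaussianFieldOfKernel fun u w => if h : u ∈ Λ ∧ w ∈ Λ then
            (Matrix.reindex e' e'
              ((Matrix.of fun p q : σ × κ =>
                  β (e p.2) (((CsDeltaCY x 𝔏 𝔢 U).restrictScalars ℝ) (Pi.single (ι q.1) (e q.2)) (ι p.1)))⁻¹ :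
                Matrix (σ × κ) (σ × κ) ℝ) : Matrix ↥Λ ↥Λ ℝ) ⟨u, h.1⟩ ⟨w, h.2⟩ else 0).map
            (fun (z : B1Eq324BenfattoLemma.Site (d + 1 + (d + 1) + 1) → ℝ) (b : σ × κ) =>
              z ((e' b : ↥Λ) : B1Eq324BenfattoLemma.Site (d + 1 + (d + 1) + 1))) =
          gaussianFieldOfKernel fun b b' =>
            ((Matrix.of fun p q : σ × κ =>
                β (e p.2) (((CsDeltaCY x 𝔏 𝔢 U).restrictScalars ℝ) (Pi.single (ι q.1) (e q.2)) (ι p.1)))⁻¹ :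
              Matrix (σ × κ) (σ × κ) ℝ) b b') ∧
        (∀ p : ℝ, 0 ≤ p →
          ((fun (z : B1Eq324BenfattoLemma.Site (d + 1 + (d + 1) + 1) → ℝ) (b : σ × κ) =>
              z ((e' b : ↥Λ) : B1Eq324BenfattoLemma.Site (d + 1 + (d + 1) + 1))) ⁻¹'
              {ω : σ × κ → ℝ | ∀ b, |ω b| ≤ p}) =ᵐ[gaussianFieldOfKernel fun u w => if h : u ∈ Λ ∧ w ∈ Λ then
                (Matrix.reindex e' e'
                  ((Matrix.of fun p q : σ × κ =>
                      β (e p.2) (((CsDeltaCY x 𝔏 𝔢 U).restrictScalars ℝ) (Pi.single (ι q.1) (e q.2)) (ι p.1)))⁻¹ :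
                    Matrix (σ × κ) (σ × κ) ℝ) : Matrix ↥Λ ↥Λ ℝ) ⟨u, h.1⟩ ⟨w, h.2⟩ else 0]
            smallFieldSet Λ p) ∧
        ∀ (s : ℕ) (I J : Finset (B1Eq324BenfattoLemma.Site (d + 1 + (d + 1) + 1))) (𝔞 : Coef (d + 1 + (d + 1) + 1)),
          I.Nonempty → J ⊆ I → J ⊆ Λ → coefSup s D 𝔞 J ≤ c * η ^ σ' →
          0 < ∫ z, cutoffBoltzmann (hamiltonian s D ϰ 𝔞 J) I (B10.pFun b₀ p₀ η) z ∂(gaussianFieldOfKernel fun u w => if h : u ∈ Λ ∧ w ∈ Λ then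
              (Matrix.reindex e' e'
                ((Matrix.of fun p q : σ × κ =>
                    β (e p.2) (((CsDeltaCY x 𝔏 𝔢 U).restrictScalars ℝ) (Pi.single (ι q.1) (e q.2)) (ι p.1)))⁻¹ :
                  Matrix (σ × κ) (σ × κ) ℝ) : Matrix ↥Λ ↥Λ ℝ) ⟨u, h.1⟩ ⟨w, h.2⟩ else 0) ∧
            |Real.log (∫ z, cutoffBoltzmann (hamiltonian s D ϰ 𝔞 J) I (B10.pFun b₀ p₀ η) z ∂(gaussianFieldOfKernel fun u w =>
                if h : u ∈ Λ ∧ w ∈ Λ then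
                  (Matrix.reindex e' e'
                    ((Matrix.of fun p q : σ × κ =>
                        β (e p.2) (((CsDeltaCY x 𝔏 𝔢 U).restrictScalars ℝ) (Pi.single (ι q.1) (e q.2)) (ι p.1)))⁻¹ :
                      Matrix (σ × κ) (σ × κ) ℝ) : Matrix ↥Λ ↥Λ ℝ) ⟨u, h.1⟩ ⟨w, h.2⟩ else 0)) -
              cumulantSum (gaussianFieldOfKernel fun u w => if h : u ∈ Λ ∧ w ∈ Λ then
                  (Matrix.reindex e' e'
                    ((Matrix.of fun p q : σ × κ =>
                        β (e p.2) (((CsDeltaCY x 𝔏 𝔢 U).restrictScalars ℝ) (Pi.single (ι q.1) (e q.2)) (ι p.1)))⁻¹ :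
                      Matrix (σ × κ) (σ × κ) ℝ) : Matrix ↥Λ ↥Λ ℝ) ⟨u, h.1⟩ ⟨w, h.2⟩ else 0)
                (hamiltonian s D ϰ 𝔞 J) t| ≤ C * η ^ κ' * I.card := by
  have hB' : 0 ≤ cβ * ne * B₀ := by positivity
  obtain ⟨b₁, hb₁⟩ := eq324_sectECovariance_node00_on_unit (d := d) κ hγ₀ hγ₁ hB' hδ₀ t D hϰ hp₀ hσ hc hκ hκσ
  refine ⟨b₁, fun b₀ hb₀ => ?_⟩
  obtain ⟨C, hC, hE⟩ := hb₁ b₀ hb₀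
  refine ⟨C, hC, ?_⟩
  intro η hη hηle ℓ hd hL w₀ w₁ Mstar x _ 𝔸 _ _ _ _ 𝔏 𝔢 U β hβ e he hβn hen σ _ _ _ ι hι hιT hTι hA hlow hup hunit hF hC' hCt hrow
  -- the letters as ℝ-linear operators on the index-bond carrier
  set A : (IBondY x.toKIdx → 𝔸) →ₗ[ℝ] (IBondY x.toKIdx → 𝔸) := (CsDeltaCY x 𝔏 𝔢 U).restrictScalars ℝ with hAdef
  set Ainv : (IBondY x.toKIdx → 𝔸) →ₗ[ℝ] (IBondY x.toKIdx → 𝔸) := (CtildeKY x 𝔏 𝔢 U).restrictScalars ℝ with hAinvdef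
  -- top level: `Λ̃ ⊂ Λ ⊂` top-level index bonds
  have htop : ∀ s, lvl x.hN x.D x.hk (ι s) = x.k := fun s => inΛY_top (𝔢.LamT_inΛ _ (hιT s))
  -- the four member rows of `T := 𝕄(C*Δ_kC)` (p665451)
  have hTs := coordMatrix_symm_of_selfAdjoint β e ι A hβ hA
  have hγ := coercive_coordMatrix β e ι A he hι hlow
  have hγ' := form_le_coordMatrix β e ι A he hι hup
  have hval : ∀ q : σ × κ, ∃ w : σ × κ → ℝ,
      Ainv (Pi.single (ι q.1) (e q.2)) = fun b => ∑ r, w r • (Pi.single (ι r.1) (e r.2) : IBondY x.toKIdx → 𝔸) b :=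
    exists_assemble_CtildeKY_single U β e he ι hι hTι hF
  have hinv : ∀ p q : σ × κ, β (e p.2) (A (Ainv (Pi.single (ι q.1) (e q.2))) (ι p.1)) =
      β (e p.2) ((Pi.single (ι q.1) (e q.2) : IBondY x.toKIdx → 𝔸) (ι p.1)) :=
    frameRead_CsDeltaCY_CtildeKY U hunit β e ι hιT
  have hInv := inv_coordMatrix_eq β e ι A he hι Ainv hval hinv
  have hker : ∀ (s s' : σ) (E : 𝔸), ‖Ainv (Pi.single (ι s') E) (ι s)‖ ≤ B₀ * ‖E‖ * Real.exp (-(δ₀ * unitDistY x (ι s) (ι s'))) :=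
    kernelReading_CtildeKY_of_row24 U hC' hCt hB₀ hrow ι hιT
  have hdec : ∀ p q : σ × κ,
      |((Matrix.of fun p q : σ × κ => β (e p.2) (A (Pi.single (ι q.1) (e q.2)) (ι p.1)))⁻¹ : Matrix (σ × κ) (σ × κ) ℝ) p q| ≤
        cβ * ne * B₀ * Real.exp (-(δ₀ * unitDistY x (ι p.1) (ι q.1))) := by
    intro p q
    rw [hInv]
    exact abs_coordMatrix_le β e ι Ainv hcβ hB₀ (fun s s' => unitDistY x (ι s) (ι s')) hβn hen hker p q
  exact hE η hη hηle x ι hι htop hTs hγ hγ' hdec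

/-- Non-vacuity of the scalar side of `eq324_CtildeKY_node00_on_unit` (the binder list elaborates end to end): `d + 1 = 4`, a `24`-element frame index
(3 × 8: bond directions × colours of `su(3)`, say), `γ₀ = 1`, `γ₁ = 5`, `B₀ = 2`, `δ₀ = 1/3`, `c_β = n_e = 1`, and the (α)-socket's letters `t = 6`, `D = 4`,
`ϰ = 1`, `p₀ = 1`, `σ = 1/2`, `c = 1`, `κ = 13/4`. [cite: Balaban1985UV3, (24) p.262, (58) p.270 (letters of the socket; instance ours)] -/
example :=
  eq324_CtildeKY_node00_on_unit (d := 3) (Fin 24) (γ₀ := 1) (γ₁ := 5) (B₀ := 2) (δ₀ := 1 / 3) (cβ := 1) (ne := 1) one_pos (by norm_num)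
    (by norm_num) (by norm_num) zero_le_one zero_le_one 6 4 (ϰ := 1) one_pos (p₀ := 1) (σ' := 1 / 2) (c := 1) (κ' := 13 / 4) (by norm_num)
    (by norm_num) zero_le_one (by norm_num) (by norm_num)

end Door

/-! ## §4  The presented covariance IS `𝕄(C̃^{(k)})` — the name print gives it -/

section Name

variable {x : MemberY d ℓ hd hL w₀ w₁ Mstar} [DecidableEq (IBondY x.toKIdx)] {𝔏 : CovLettersY 𝔸 x} {𝔢 : SectELettersY 𝔸 x}
variable {κ : Type} [Fintype κ] [DecidableEq κ] {σ : Type} [Fintype σ] [DecidableEq σ]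

/-- ★ **`𝕄(C*Δ_kC)⁻¹ = 𝕄(C̃^{(k)}(Λ))`** at the letters: under (R4), (R5) and along a bijection `ι : σ → Λ̃` with an orthonormal frame, the inverse of the
coordinate matrix of `C*Δ_kC` is the coordinate matrix of def-Y's `CtildeKY` — the covariance presented by `eq324_CtildeKY_node00_on_unit` is (3.158)'s
`C̃^{(k)}(Λ; U)` read in coordinates (p665451 `inv_coordMatrix_eq` ∘ §2). [cite: Balaban1985BackgroundPropagators, (3.158) p.428] -/
theorem inv_coordMatrix_CsDeltaCY_eq (U : CfgY 𝔸 x.toKIdx) (hunit : IsUnit (secCornerY 𝔸 𝔢.LamT (CsDeltaCY x 𝔏 𝔢 U)))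
    (β : 𝔸 →ₗ[ℝ] 𝔸 →ₗ[ℝ] ℝ) (e : κ → 𝔸) (he : ∀ c c', β (e c) (e c') = if c = c' then 1 else 0)
    (ι : σ → IBondY x.toKIdx) (hι : Function.Injective ι) (hιT : ∀ s, 𝔢.LamT (ι s)) (hTι : ∀ b, 𝔢.LamT b → b ∈ Set.range ι)
    (hF : ∀ (q : σ × κ) (b : IBondY x.toKIdx), CtildeKY x 𝔏 𝔢 U (Pi.single (ι q.1) (e q.2)) b ∈ Submodule.span ℝ (Set.range e)) :
    (Matrix.of fun p q : σ × κ => β (e p.2) (((CsDeltaCY x 𝔏 𝔢 U).restrictScalars ℝ) (Pi.single (ι q.1) (e q.2)) (ι p.1)))⁻¹ =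
      Matrix.of fun p q : σ × κ => β (e p.2) (((CtildeKY x 𝔏 𝔢 U).restrictScalars ℝ) (Pi.single (ι q.1) (e q.2)) (ι p.1)) :=
  inv_coordMatrix_eq β e ι _ he hι _ (exists_assemble_CtildeKY_single U β e he ι hι hTι hF)
    (frameRead_CsDeltaCY_CtildeKY U hunit β e ι hιT)

end Name

/-! ## §5  At def-Y's GENUINE letters `C = elimCY`, `C* = elimCtY`, `Λ̃ = lamTY` (`Node00.OpsYSectEElim`): row (R6) DISCHARGED -/

section Genuine

variable {x : MemberY d ℓ hd hL w₀ w₁ Mstar} (𝔳 : AvY 𝔸 x)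

/-- ★ **`P_Λ̃·C(V)·P_Λ̃ = P_Λ̃` FOR def-Y's GENUINE `C`** — print's «an identity operator on almost all bonds»: on `Λ̃` the parametrisation returns the variable
itself (def-Y's `elimCY_apply_of_lamTY`), so (R6)'s first identity HOLDS at the letter of record. [cite: Balaban1985BackgroundPropagators, (3.157) p.428] -/
theorem secY_mul_elimCY_mul_secY (U : CfgY 𝔸 x.toKIdx) :
    secY 𝔸 (lamTY x) * elimCY x 𝔳 U * secY 𝔸 (lamTY x) = secY 𝔸 (lamTY x) := by
  apply LinearMap.ext
  intro B
  funext q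
  rw [Module.End.mul_apply, Module.End.mul_apply]
  by_cases hq : lamTY x q
  · rw [secY_apply_of hq, elimCY_apply_of_lamTY x 𝔳 U _ hq, secY_apply_of hq]
  · rw [secY_apply_of_not hq, secY_apply_of_not hq]

/-- ★ **`P_Λ̃·C(V)*·P_Λ̃ = P_Λ̃` FOR def-Y's GENUINE `C*`**: the pivot corrections of `C*` read the argument at the pivot bonds `b₀(c) ∉ Λ̃` (def-Y's `elimCtY_eq`,
`not_lamTY_pivIY`), so they vanish on `Λ̃`-supported arguments and (R6)'s second identity HOLDS at the letter of record. [cite: Balaban1985BackgroundPropagators, (3.157) p.428] -/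
theorem secY_mul_elimCtY_mul_secY (U : CfgY 𝔸 x.toKIdx) :
    secY 𝔸 (lamTY x) * elimCtY x 𝔳 U * secY 𝔸 (lamTY x) = secY 𝔸 (lamTY x) := by
  apply LinearMap.ext
  intro A
  have hP : ∀ f : IBondY x.toKIdx → 𝔸, secY 𝔸 (lamTY x) (secY 𝔸 (lamTY x) f) = secY 𝔸 (lamTY x) f := fun f => by
    rw [← Module.End.mul_apply, secY_idem]
  have hpiv : ∀ c, secY 𝔸 (lamTY x) A (Node00.pivIY x c) = 0 := fun c => secY_apply_of_not (not_lamTY_pivIY x c) A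
  rw [Module.End.mul_apply, Module.End.mul_apply, elimCtY_eq]
  simp only [hpiv, map_zero, Finset.sum_const_zero, sub_zero, hP]

/-- ★★★ **(3.24) FOR `dμ_{C̃^{(k)}(Λ; U)}` AT def-Y's GENUINE SEVEN-LETTER SECT. E RECORD `sectELettersYOfRecordTC x 𝔳 𝔢₀`** (`Λ̃ = lamTY`, `C = elimCY`,
`C* = elimCtY` genuine over the averaged-field parameter `𝔳`; `⟨D̃⁽²⁾, J⟩`, `G̃₂` still `𝔢₀`'s parameters): §3's door with row (R6) DISCHARGED by
`secY_mul_elimCY_mul_secY` ∕ `secY_mul_elimCtY_mul_secY`; rows (R1)–(R5), (R7) remain displayed at the letters.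
[cite: Balaban1985BackgroundPropagators, (3.155)–(3.158) pp.427–428, Thm 3.15 (3.187) p.432; Balaban1985UV3, (24) p.262, (58) p.270, pp.271–272; Balaban1982Higgs1,
(3.24) p.616; BenfattoEtAl1978, Lemma (4.5)–(4.7) p.152 (class form; ours)] -/
theorem eq324_CtildeKY_node00_ofRecordTC_on_unit (κ : Type) [Fintype κ] [DecidableEq κ] [Nonempty κ] {γ₀ γ₁ B₀ δ₀ cβ ne : ℝ}
    (hγ₀ : 0 < γ₀) (hγ₁ : 0 < γ₁) (hB₀ : 0 ≤ B₀) (hδ₀ : 0 < δ₀) (hcβ : 0 ≤ cβ) (hne : 0 ≤ ne) (t D : ℕ) {ϰ : ℝ} (hϰ : 0 < ϰ)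
    {p₀ σ' c κ' : ℝ} (hp₀ : 2 / 3 < p₀) (hσ : 0 < σ') (hc : 0 ≤ c) (hκ : 0 < κ') (hκσ : κ' < σ' * (t + 1)) :
    ∃ b₁ : ℝ, ∀ b₀ : ℝ, b₁ < b₀ → ∃ C : ℝ, 0 ≤ C ∧ ∀ η : ℝ, 0 < η → η ≤ 1 →
      ∀ {ℓ : ℕ} {hd : 1 ≤ d + 1} {hL : Odd (ℓ + 1) ∧ 1 < ℓ + 1} {w₀ w₁ : ℝ} {Mstar : ℕ} (x : MemberY d ℓ hd hL w₀ w₁ Mstar)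
        [DecidableEq (IBondY x.toKIdx)] {𝔸 : Type} [NormedRing 𝔸] [NormedAlgebra ℂ 𝔸] [CompleteSpace 𝔸] [FiniteDimensional ℝ 𝔸]
        (𝔏 : CovLettersY 𝔸 x) (𝔳 : AvY 𝔸 x) (𝔢₀ : SectELettersY 𝔸 x) (U : CfgY 𝔸 x.toKIdx)
        (β : 𝔸 →ₗ[ℝ] 𝔸 →ₗ[ℝ] ℝ), (∀ a b, β a b = β b a) →
      ∀ (e : κ → 𝔸), (∀ c c', β (e c) (e c') = if c = c' then 1 else 0) → (∀ (c : κ) (v : 𝔸), |β (e c) v| ≤ cβ * ‖v‖) →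
        (∀ c, ‖e c‖ ≤ ne) →
      ∀ {σ : Type} [Fintype σ] [DecidableEq σ] [Nonempty σ] (ι : σ → IBondY x.toKIdx), Function.Injective ι →
        (∀ s, lamTY x (ι s)) → (∀ b, lamTY x b → b ∈ Set.range ι) →
        (∀ Φ Ψ : IBondY x.toKIdx → 𝔸,
          ∑ b, β (Ψ b) (((CsDeltaCY x 𝔏 (sectELettersYOfRecordTC x 𝔳 𝔢₀) U).restrictScalars ℝ) Φ b) =
          ∑ b, β (((CsDeltaCY x 𝔏 (sectELettersYOfRecordTC x 𝔳 𝔢₀) U).restrictScalars ℝ) Ψ b) (Φ b)) →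
        (∀ Φ : IBondY x.toKIdx → 𝔸, (∀ b, b ∉ Set.range ι → Φ b = 0) → (∀ b, Φ b ∈ Submodule.span ℝ (Set.range e)) →
          γ₀ * ∑ b, β (Φ b) (Φ b) ≤ ∑ b, β (Φ b) (((CsDeltaCY x 𝔏 (sectELettersYOfRecordTC x 𝔳 𝔢₀) U).restrictScalars ℝ) Φ b)) →
        (∀ Φ : IBondY x.toKIdx → 𝔸, (∀ b, b ∉ Set.range ι → Φ b = 0) → (∀ b, Φ b ∈ Submodule.span ℝ (Set.range e)) →
          ∑ b, β (Φ b) (((CsDeltaCY x 𝔏 (sectELettersYOfRecordTC x 𝔳 𝔢₀) U).restrictScalars ℝ) Φ b) ≤ γ₁ * ∑ b, β (Φ b) (Φ b)) →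
        IsUnit (secCornerY 𝔸 (lamTY x) (CsDeltaCY x 𝔏 (sectELettersYOfRecordTC x 𝔳 𝔢₀) U)) →
        (∀ (q : σ × κ) (b : IBondY x.toKIdx),
          CtildeKY x 𝔏 (sectELettersYOfRecordTC x 𝔳 𝔢₀) U (Pi.single (ι q.1) (e q.2)) b ∈ Submodule.span ℝ (Set.range e)) →
        (∀ b b' : IBondY x.toKIdx, inΛY x b → inΛY x b' →
          (⨆ E : BallY 𝔸, ‖CkY x 𝔏 (sectELettersYOfRecordTC x 𝔳 𝔢₀) U (deltaY b' (E : 𝔸)) b‖) ≤ B₀ * Real.exp (-(δ₀ * unitDistY x b b'))) →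
      ∃ (Λ : Finset (B1Eq324BenfattoLemma.Site (d + 1 + (d + 1) + 1))) (e' : σ × κ ≃ ↥Λ),
        ((gaussianFieldOfKernel fun u w => if h : u ∈ Λ ∧ w ∈ Λ then
            (Matrix.reindex e' e'
              ((Matrix.of fun p q : σ × κ =>
                  β (e p.2) (((CsDeltaCY x 𝔏 (sectELettersYOfRecordTC x 𝔳 𝔢₀) U).restrictScalars ℝ)
                    (Pi.single (ι q.1) (e q.2)) (ι p.1)))⁻¹ :
                Matrix (σ × κ) (σ × κ) ℝ) : Matrix ↥Λ ↥Λ ℝ) ⟨u, h.1⟩ ⟨w, h.2⟩ else 0).map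
            (fun (z : B1Eq324BenfattoLemma.Site (d + 1 + (d + 1) + 1) → ℝ) (b : σ × κ) =>
              z ((e' b : ↥Λ) : B1Eq324BenfattoLemma.Site (d + 1 + (d + 1) + 1))) =
          gaussianFieldOfKernel fun b b' =>
            ((Matrix.of fun p q : σ × κ =>
                β (e p.2) (((CsDeltaCY x 𝔏 (sectELettersYOfRecordTC x 𝔳 𝔢₀) U).restrictScalars ℝ)
                  (Pi.single (ι q.1) (e q.2)) (ι p.1)))⁻¹ :
              Matrix (σ × κ) (σ × κ) ℝ) b b') ∧
        (∀ p : ℝ, 0 ≤ p →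
          ((fun (z : B1Eq324BenfattoLemma.Site (d + 1 + (d + 1) + 1) → ℝ) (b : σ × κ) =>
              z ((e' b : ↥Λ) : B1Eq324BenfattoLemma.Site (d + 1 + (d + 1) + 1))) ⁻¹'
              {ω : σ × κ → ℝ | ∀ b, |ω b| ≤ p}) =ᵐ[gaussianFieldOfKernel fun u w => if h : u ∈ Λ ∧ w ∈ Λ then
                (Matrix.reindex e' e'
                  ((Matrix.of fun p q : σ × κ =>
                      β (e p.2) (((CsDeltaCY x 𝔏 (sectELettersYOfRecordTC x 𝔳 𝔢₀) U).restrictScalars ℝ)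
                        (Pi.single (ι q.1) (e q.2)) (ι p.1)))⁻¹ :
                    Matrix (σ × κ) (σ × κ) ℝ) : Matrix ↥Λ ↥Λ ℝ) ⟨u, h.1⟩ ⟨w, h.2⟩ else 0]
            smallFieldSet Λ p) ∧
        ∀ (s : ℕ) (I J : Finset (B1Eq324BenfattoLemma.Site (d + 1 + (d + 1) + 1))) (𝔞 : Coef (d + 1 + (d + 1) + 1)),
          I.Nonempty → J ⊆ I → J ⊆ Λ → coefSup s D 𝔞 J ≤ c * η ^ σ' →
          0 < ∫ z, cutoffBoltzmann (hamiltonian s D ϰ 𝔞 J) I (B10.pFun b₀ p₀ η) z ∂(gaussianFieldOfKernel fun u w => if h : u ∈ Λ ∧ w ∈ Λ then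
              (Matrix.reindex e' e'
                ((Matrix.of fun p q : σ × κ =>
                    β (e p.2) (((CsDeltaCY x 𝔏 (sectELettersYOfRecordTC x 𝔳 𝔢₀) U).restrictScalars ℝ)
                      (Pi.single (ι q.1) (e q.2)) (ι p.1)))⁻¹ :
                  Matrix (σ × κ) (σ × κ) ℝ) : Matrix ↥Λ ↥Λ ℝ) ⟨u, h.1⟩ ⟨w, h.2⟩ else 0) ∧
            |Real.log (∫ z, cutoffBoltzmann (hamiltonian s D ϰ 𝔞 J) I (B10.pFun b₀ p₀ η) z ∂(gaussianFieldOfKernel fun u w =>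
                if h : u ∈ Λ ∧ w ∈ Λ then
                  (Matrix.reindex e' e'
                    ((Matrix.of fun p q : σ × κ =>
                        β (e p.2) (((CsDeltaCY x 𝔏 (sectELettersYOfRecordTC x 𝔳 𝔢₀) U).restrictScalars ℝ)
                          (Pi.single (ι q.1) (e q.2)) (ι p.1)))⁻¹ :
                      Matrix (σ × κ) (σ × κ) ℝ) : Matrix ↥Λ ↥Λ ℝ) ⟨u, h.1⟩ ⟨w, h.2⟩ else 0)) -
              cumulantSum (gaussianFieldOfKernel fun u w => if h : u ∈ Λ ∧ w ∈ Λ then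
                  (Matrix.reindex e' e'
                    ((Matrix.of fun p q : σ × κ =>
                        β (e p.2) (((CsDeltaCY x 𝔏 (sectELettersYOfRecordTC x 𝔳 𝔢₀) U).restrictScalars ℝ)
                          (Pi.single (ι q.1) (e q.2)) (ι p.1)))⁻¹ :
                      Matrix (σ × κ) (σ × κ) ℝ) : Matrix ↥Λ ↥Λ ℝ) ⟨u, h.1⟩ ⟨w, h.2⟩ else 0)
                (hamiltonian s D ϰ 𝔞 J) t| ≤ C * η ^ κ' * I.card := by
  obtain ⟨b₁, hb₁⟩ := eq324_CtildeKY_node00_on_unit (d := d) κ hγ₀ hγ₁ hB₀ hδ₀ hcβ hne t D hϰ hp₀ hσ hc hκ hκσ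
  refine ⟨b₁, fun b₀ hb₀ => ?_⟩
  obtain ⟨C, hC, hE⟩ := hb₁ b₀ hb₀
  refine ⟨C, hC, ?_⟩
  intro η hη hηle ℓ hd hL w₀ w₁ Mstar x _ 𝔸 _ _ _ _ 𝔏 𝔳 𝔢₀ U β hβ e he hβn hen σ _ _ _ ι hι hιT hTι hA hlow hup hunit hF hrow
  exact hE η hη hηle x 𝔏 (sectELettersYOfRecordTC x 𝔳 𝔢₀) U β hβ e he hβn hen ι hι hιT hTι hA hlow hup hunit hF
    (secY_mul_elimCY_mul_secY 𝔳 U) (secY_mul_elimCtY_mul_secY 𝔳 U) hrow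

end Genuine

end Literature.MathematicalPhysics.QuantumFieldTheory.Balaban1983to89.B1Eq324BenfattoClassSectEMemberAtLetters
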